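import Summits.CriticalPhenomena.PercolationContinuityZ3.Theorems.SahiMasterFamilyAnnihilator
import Literature.Combinatorics.Sahi2008.IndependentAtoms

/-!
# Independent frames under a product measure: the all-order positivity of the tree's independent-atoms theorem, for events

Unit `prim-master-conj` (crux anchor stmt-CriticalPhenomena-4575); a bridge file.  The tree proves, for every order and
every FKG weight, `E_{n+2}(F) = n!·Σ_{j≠s} Cov(F_j, Π_{l≠j} F_l) ≥ 0` as soon as the functions OFF one slot `s` have
multiplicative joint moments (`Literature.Combinatorics.Sahi2008.sahiE_eq_sum_cov_of_indepMoments`,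
`sahiE_nonneg_of_indepMoments_of_isFKGMeasure`).  Here the hypothesis is discharged for INDICATORS OF INCREASING EVENTS
under `μ_p`: events determined by pairwise disjoint coordinate sets have multiplicative joint moments
(`ex_prod_ind_eq_prod_ex`), so `E_{n+2}(1_{F_0},…,1_{F_{n+1}}) ≥ 0` whenever the events off one slot have pairwise
disjoint essential supports — an **independent frame plus one arbitrary increasing event**
(`sahiE_ind_nonneg_of_frame`).  This is the engine of the order-`k` step of the master conjecture on families with a
`Z_{k−1}` sub-family (orders 3, 4 in the tree; order 5 on paper, K4-NOTES §8 of the unit).  Everything proved; axioms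
standard. [this work]
-/

noncomputable section

open scoped Classical

namespace Summit.CriticalPhenomena.PercolationContinuityZ3.Theorems

open Finset Function
open Literature.Combinatorics.Sahi2008
open Literature.Probability.Percolation (DeterminedBy determinedBy_iff determinedBy_univ)
open Literature.Probability.LatticeModels (prodBernoulli prodBernoulli_real_inter_of_determinedBy_disjoint)
open Literature.Probability.Percolation.DecisionTree (ind ind_nonneg)

variable {ι : Type*} [Fintype ι]

omit [Fintype ι] in
/-- A product of indicators is the indicator of the intersection. [folklore] -/
theorem prod_ind_eq_ind_biInter {m : ℕ} (A : Fin m → Set (Set ι)) (S : Finset (Fin m)) :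
    ∏ j ∈ S, ind (A j) = ind (⋂ j ∈ S, A j) := by
  induction S using Finset.induction_on with
  | empty =>
    funext ω
    simp only [prod_empty, Pi.one_apply]
    exact (Literature.Probability.Percolation.DecisionTree.ind_of_mem (by simp)).symm
  | insert a S haS ih =>
    rw [prod_insert haS, ih, set_biInter_insert]
    funext ω
    exact (Literature.Probability.Percolation.BHK2006.ind_inter _ _ ω).symm

omit [Fintype ι] in
/-- An intersection of events determined by sets `T j` is determined by their union. [folklore] -/
theorem determinedBy_biInter {m : ℕ} (A : Fin m → Set (Set ι)) (T : Fin m → Finset ι) (S : Finset (Fin m))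
    (hA : ∀ j ∈ S, DeterminedBy (A j) (↑(T j) : Set ι)) :
    DeterminedBy (⋂ j ∈ S, A j) (↑(S.biUnion T) : Set ι) := by
  induction S using Finset.induction_on with
  | empty => simp only [notMem_empty, Set.iInter_of_empty, Set.iInter_univ]; exact determinedBy_univ _
  | insert a S haS ih =>
    rw [set_biInter_insert]
    refine DeterminedBy.inter ?_ ?_
    · exact (hA a (mem_insert_self a S)).mono (by
        rw [coe_subset]; exact subset_biUnion_of_mem T (mem_insert_self a S))
    · exact (ih fun j hj => hA j (mem_insert_of_mem hj)).mono (by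
        rw [coe_subset]; exact biUnion_subset_biUnion_of_subset_left T (subset_insert a S))

/-- **Multiplicative joint moments of an independent frame**: indicators of events determined by pairwise disjoint
coordinate sets have `E(Π_{j∈S} 1_{A_j}) = Π_{j∈S} P(A_j)` under `μ_p`. [this work] -/
theorem ex_prod_ind_eq_prod_ex (p : ι → unitInterval) {m : ℕ} (A : Fin m → Set (Set ι)) (T : Fin m → Finset ι)
    (S : Finset (Fin m)) (hA : ∀ j ∈ S, DeterminedBy (A j) (↑(T j) : Set ι))
    (hT : ∀ j ∈ S, ∀ j' ∈ S, j ≠ j' → Disjoint (T j) (T j')) :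
    ex (bernoulliWeight p) (∏ j ∈ S, ind (A j)) = ∏ j ∈ S, ex (bernoulliWeight p) (ind (A j)) := by
  induction S using Finset.induction_on with
  | empty => simp only [prod_empty]; exact ex_one (sum_bernoulliWeight p)
  | insert a S haS ih =>
    have hA' : ∀ j ∈ S, DeterminedBy (A j) (↑(T j) : Set ι) := fun j hj => hA j (mem_insert_of_mem hj)
    have hT' : ∀ j ∈ S, ∀ j' ∈ S, j ≠ j' → Disjoint (T j) (T j') :=
      fun j hj j' hj' hne => hT j (mem_insert_of_mem hj) j' (mem_insert_of_mem hj') hne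
    rw [prod_insert haS, prod_insert haS, ← ih hA' hT', prod_ind_eq_ind_biInter]
    have hmul : ind (A a) * ind (⋂ j ∈ S, A j) = ind (A a ∩ ⋂ j ∈ S, A j) := by
      funext ω; exact (Literature.Probability.Percolation.BHK2006.ind_inter _ _ ω).symm
    rw [hmul, ex_bernoulliWeight_ind, ex_bernoulliWeight_ind, ex_bernoulliWeight_ind]
    refine prodBernoulli_real_inter_of_determinedBy_disjoint p ?_ (hA a (mem_insert_self a S))
      (determinedBy_biInter A T S hA') MeasurableSet.of_discrete MeasurableSet.of_discrete
    rw [Finset.disjoint_biUnion_right]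
    intro j hj
    exact hT a (mem_insert_self a S) j (mem_insert_of_mem hj) (fun h => haS (h ▸ hj))

/-- **Sahi positivity on an independent frame plus one event, every order**: if the increasing events `F_j`, `j ≠ s`,
have pairwise disjoint essential supports then `0 ≤ E_{n+2}(μ_p; 1_{F_0},…,1_{F_{n+1}})` (the event `F_s` arbitrary
increasing), for every `p ∈ [0,1]^ι`. [this work] -/
theorem sahiE_ind_nonneg_of_frame (p : ι → unitInterval) {n : ℕ} (F : Fin (n + 2) → Set (Set ι))
    (hF : ∀ j, IsUpperSet (F j)) (s : Fin (n + 2))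
    (hd : ∀ j j', j ≠ s → j' ≠ s → j ≠ j' → Disjoint (esupp (F j)) (esupp (F j'))) :
    0 ≤ sahiE (bernoulliWeight p) (n + 2) (fun j => ind (F j)) := by
  refine sahiE_nonneg_of_indepMoments_of_isFKGMeasure (isFKGMeasure_bernoulliWeight p) n _ s ?_
    (fun j ω => ind_nonneg _ _) (fun j => monotone_ind_of_isUpperSet (hF j))
  intro S hs
  refine ex_prod_ind_eq_prod_ex p F (fun j => esupp (F j)) S (fun j _ => determinedBy_esupp (hF j)) ?_
  intro j hj j' hj' hne
  exact hd j j' (fun h => hs (h ▸ hj)) (fun h => hs (h ▸ hj')) hne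

end Summit.CriticalPhenomena.PercolationContinuityZ3.Theorems
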